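import Summits.BirchSwinnertonDyer.Rank1Residual.Additive.ShaDivisibilityOfControl
import Summits.BirchSwinnertonDyer.Rank1Residual.Additive.CongruentLambdaShiftOfGVTorsionIso
import Summits.BirchSwinnertonDyer.Rank1Residual.Additive.GoodModelKummerOfCoatesGreenberg
import HarnessLib

/-!
# The LOWER half and `BSD(E,p)` on a rank-`0` X4♯(G-ord) ∩ `I₀*` row with `#Ш_an = p²·unit` from a
# TRIVIAL CONGRUENT PARTNER with positive δ-shift — every input PRINTED or census
# (team n1011, row T-CTL-EC, seat p06 GEN 9, FILE 5 — the Greenberg–Vatsal feed of FILE 4)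

HONEST FRAMING (cell `b2b-bsdres-*`, team n1011, verbatim): prove what is provable now; shrink each
hard class to its core with data; no claim beyond stated classes. Research route on
CONSTRUCTION-SHAPED X4 / §I N10–N11; CONSUMER theorems only — no definition, no named fact, nothing
booked, no residual-map mark moved, no class closed: the ENDs below are PER-PAIR shapes (receiver +
partner + `TorsionIso` certificate + δ-inequality); which pairs of the registers satisfy them is
census business, not claimed here.

## What

FILE 4 (`Additive/ShaDivisibilityOfControl`) turns ONE Iwasawa bit `λ(X(E₂/ℚ_∞)) ≠ 0` into
`p ∣ #Ш(E₂)`, `p² ∣ #Ш(E₂)` (Cassels–Tate) and `BSD(E₂,p)` on rank-`0` rows with `ord_p #Ш_an ≤ 2`.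
This file FEEDS the bit from the cell's Greenberg–Vatsal transfer of record: for an X4♯(G-ord) ∩ `I₀*`
(defect `e = 2`) pair `E₁[p] ≅ E₂[p]` (`TorsionIso W₁ W₂ p`, the I1 certificate) the tree gives
`CongruentLambdaShift W₁ W₂ p (Σ_{w ∈ S₀} (δ_w(E₂) − δ_w(E₁)))` and `μ(E₁) = 0 ⟹ μ(E₂) = 0`
(`ClassX4Gord.congruentLambdaShift_of_gv_of_torsionIso`, `ClassX4Gord.mu_eq_zero_of_gv_of_torsionIso`,
over the registered A240 `hGV` and Coates–Greenberg `hCG` for the ramified-line Kummer identity);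
if the partner `E₁` is TRIVIAL at `p` (`#Sel_{p^∞}(E₁/ℚ) = 1` + numeric sockets ⟹ `X(E₁/ℚ_∞) = 0`,
T-T3CTL F1 with T-T3B F7) then `λ(E₁) = μ(E₁) = 0`, so `λ(E₂) = Σ_{S₀} (δ(E₁) − δ(E₂))`, which is
`≠ 0` as soon as `Σ δ(E₂) < Σ δ(E₁)`.

* `lambda_ne_zero_of_congruentLambdaShift_of_subsingleton` — generic: `CongruentLambdaShift W₁ W₂ p e`,
  `X₁ = 0`, `X₂` torsion with `μ = 0`, `e < 0` ⟹ `λ(X₂) ≠ 0`;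
* `ClassX4Gord.lambda_ne_zero_of_gv_of_trivialPartner` — the pair shape: PRINTED {`hGV`, `hCG`, GZK} +
  partner census {`hX₁`, `e₁ = 2`, `#Sel_{p^∞}(E₁) = 1`, numeric sockets} + receiver census {`hX₂`,
  `e₂ = 2`, `r_an = 0`, numeric sockets} + link {`TorsionIso`, `S₀`, `Σ δ(E₂) < Σ δ(E₁)`} ⟹
  `λ(X(E₂/ℚ_∞)) ≠ 0` for every cyclotomic dual datum;
* `ClassX4Gord.sq_dvd_card_sha_rankZero_of_gv_of_trivialPartner_of_casselsTate` — **`p² ∣ #Ш(E₂)`**;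
* `ClassX4Gord.missingLowerBoundAt_rankZero_of_gv_of_trivialPartner_of_casselsTate` — **the LOWER
  half on the receiver when `ord_p #Ш_an(E₂) ≤ 2`, NO typed input**;
* `ClassX4Gord.bsdp_rankZero_of_gv_of_trivialPartner_of_casselsTate_maninFree` — **`BSD(E₂,p)`**
  (`p ≥ 5`, `ρ̄_{E₂,p}` onto, `p ∤ ∏ c_ℓ(E₂)`; upper half = additive-p4's Manin-free Kato reading).

Named facts consumed as hypotheses (all PUBLISHED / registered): Cassels–Tate (`exists_casselsTate_pairing`),
A240 `muLambdaAlg_transfer_of_torsionIso_potOrd_of_not_dvd_torsionOrder` (Greenberg–Vatsal 2000 §2 +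
Greenberg 1999 Prop. 4.14; derived in the tree from two records, `…_of_records`),
`H1_goodModelKernel_trivial` (Coates–Greenberg 1996), GZK, and for the capstone Kato 14.5 (3) Manin-free,
Delbourgo 1998 Prop. 4, modularity, Wuthrich–Kato component. Axioms standard.

References: [GreenbergVatsal2000] §2 Prop. (2.8), Rem. (2.9), Cor. (2.3), p. 27; [GreenbergLNM1716] §3
Prop. 3.8, §4 Thm. 4.1; [SilvermanAEC2009] Thm. X.4.14; [CoatesGreenberg1996]; [Miller2011LMS]
Def. 1.1; cells/n1011/skel/T-CTL-EC.md.
-/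

noncomputable section

open scoped Classical NumberField

open WeierstrassCurve NumberField IsDedekindDomain Field
  Literature.NumberTheory.GaloisRepresentations
  Literature.NumberTheory.EllipticCurves
  Literature.NumberTheory.EllipticCurves.ModularForms
  Literature.NumberTheory.EllipticCurves.Rank1Residual
  Literature.NumberTheory.EllipticCurves.Rank1Residual.Typed
  Literature.NumberTheory.EllipticCurves.GreenbergVatsal2000
  Literature.NumberTheory.EllipticCurves.CoatesGreenberg1996
  Rat.HeightOneSpectrum Summit.BirchSwinnertonDyer.Rank1Residual.Iwasawa
  Summit.BirchSwinnertonDyer.Rank1Residual.X1.CongruenceTransfer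

namespace Summit.BirchSwinnertonDyer.Rank1Residual.Additive

/-! ### §1 `λ(X₂) ≠ 0` from a λ-shift and a trivial partner -/

section Generic

variable {W₁ W₂ : WeierstrassCurve ℚ} [W₁.IsElliptic] [W₁.IsGloballyMinimal] [W₂.IsElliptic]
  [W₂.IsGloballyMinimal] {p : ℕ} [hp : Fact p.Prime]

/-- **`λ(X₂) ≠ 0` from a congruence λ-shift and a trivial partner.** If
`CongruentLambdaShift W₁ W₂ p e` (`λ(X₁) = λ(X₂) + e` for all cyclotomic dual data with `μ = 0`),
`TorsionIso W₁ W₂ p`, `X(E₁/ℚ_∞) = 0` (`Subsingleton D₁.X`), `X(E₂/ℚ_∞)` is `Λ`-torsion with `μ = 0`,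
and `e < 0`, then `λ(X(E₂/ℚ_∞)) ≠ 0`. Bookkeeping over the typed node. [cite: GreenbergVatsal2000, §2 p. 27 (the λ-identity)] -/
theorem lambda_ne_zero_of_congruentLambdaShift_of_subsingleton {e : ℤ}
    (hT : TorsionIso W₁ W₂ p) (hshift : CongruentLambdaShift W₁ W₂ p e) (he : e < 0)
    {κ : ZpExtension ℚ p} {γ : Field.absoluteGaloisGroup ℚ} (hκ : κ.IsCyclotomic)
    (hγ : κ.IsTopGenerator γ) (hγ' : IsCyclotomicVariable p γ)
    (D₁ : W₁.SelmerDualData κ γ) (D₂ : W₂.SelmerDualData κ γ) [Subsingleton D₁.X]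
    (hX₂t : D₂.IsTorsion) (hμ₂ : D₂.mu = 0) : D₂.lambda ≠ 0 := by
  haveI : Module.Finite (IwasawaAlgebra p) D₁.X :=
    SelmerDualData.module_finite_of_isCyclotomic (W := W₁) (κ := κ) hκ D₁ hγ
  haveI : Module.Finite (IwasawaAlgebra p) D₂.X :=
    SelmerDualData.module_finite_of_isCyclotomic (W := W₂) (κ := κ) hκ D₂ hγ
  have h1lam : lambdaInvariant p D₁.X = 0 := lambda_eq_zero_of_subsingleton D₁
  have h := hshift hT κ γ hκ hγ hγ' D₁ D₂ (isTorsion_of_subsingleton D₁) hX₂t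
    (mu_eq_zero_of_subsingleton D₁) hμ₂
  rw [h1lam] at h
  change lambdaInvariant p D₂.X ≠ 0
  omega

end Generic

/-! ### §2 The X4♯(G-ord) ∩ `I₀*` pair with a trivial partner -/

section Pair

variable {W₁ W₂ : WeierstrassCurve ℚ} [W₁.IsElliptic] [W₁.IsGloballyMinimal] [W₂.IsElliptic]
  [W₂.IsGloballyMinimal] {p : ℕ} [hp : Fact p.Prime]

/-- All level-`0` local tower kernels of an X4♯(G-ord) curve vanish when every bad place away from `p`
passes the numeric test (`v = p`: T-T3B F7; `v ∤ p` bad: F2c; good: the tree's Lemma 3.3).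
[cite: GreenbergLNM1716, §3 Prop. 3.8 (pp. 95–96), Lemma 3.4 (p. 89), Lemma 3.3 (p. 87)] -/
theorem ClassX4Gord.localTowerKerPrimary_zero_eq_bot_of_allNumeric {W : WeierstrassCurve ℚ}
    [W.IsElliptic] [W.IsGloballyMinimal] (hX : ClassX4Gord W p) (κ : ZpExtension ℚ p)
    (S : Finset (HeightOneSpectrum (𝓞 ℚ)))
    (hS : ∀ v ∈ S, (p : 𝓞 ℚ) ∉ v.asIdeal →
      (primesEquiv v : ℕ) ≠ p ∧ ¬ p ∣ (W.baseChange (v.adicCompletion ℚ)).localTamagawaNumber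
        (v.adicCompletionIntegers ℚ) * reductionPointCount W (primesEquiv v : ℕ))
    (hgood : ∀ v ∉ S, (p : 𝓞 ℚ) ∉ v.asIdeal ∧ W.HasGoodReductionAt v)
    (v : HeightOneSpectrum (𝓞 ℚ)) : W.localTowerKerPrimary κ (v.adicCompletion ℚ) 0 = ⊥ := by
  refine localTowerKerPrimary_zero_eq_bot_of_finset W κ S (fun v hv ↦ ?_) hgood v
  by_cases hpv : (p : 𝓞 ℚ) ∈ v.asIdeal
  · exact GoodModelLine.ClassX4Gord.localTowerKerPrimary_zero_eq_bot hX hpv κ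
  · obtain ⟨hne, hnum⟩ := hS v hv hpv
    haveI : Fact (Nat.Prime (primesEquiv v : ℕ)) := ⟨(primesEquiv v).2⟩
    exact localTowerKerPrimary_zero_eq_bot_of_not_dvd W κ v (primesEquiv v : ℕ) rfl hne hpv hnum

/-- **X4♯(G-ord) ∩ `I₀*` pair, TRIVIAL partner, positive δ-shift ⟹ `λ(X(E₂/ℚ_∞)) ≠ 0`** for every
cyclotomic dual datum `D₂`. Inputs: the registered A240 `hGV` and Coates–Greenberg `hCG` (ramified-line
Kummer identity), GZK (receiver: `Sel_{p^∞}(E₂/ℚ)` finite in analytic rank `0`, giving `X₂` torsion by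
FILE 1's control identity — no Delbourgo (A)); census: `hX₁, e₁ = 2, #Sel_{p^∞}(E₁/ℚ) = 1`, numeric
sockets of `E₁`; `hX₂, e₂ = 2, r_an(E₂) = 0`, numeric sockets of `E₂`; link: `TorsionIso W₁ W₂ p`,
`S₀ ∌ p` containing every bad place of both, `Σ_{S₀} δ(E₂) < Σ_{S₀} δ(E₁)`. Nothing booked.
[cite: GreenbergVatsal2000, §2 Prop. (2.8) with Remark (2.9), Cor. (2.3), pp. 26–27 (arXiv:math/9906215)]
[cite: GreenbergLNM1716, §3 Prop. 3.8 (pp. 95–96) and §4 Thm. 4.1 (pp. 102–104)] -/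
theorem ClassX4Gord.lambda_ne_zero_of_gv_of_trivialPartner
    (hGV : muLambdaAlg_transfer_of_torsionIso_potOrd_of_not_dvd_torsionOrder)
    (hCG : H1_goodModelKernel_trivial.{0}) (hGZK : rank_eq_analyticRank_of_analyticRank_le_one)
    -- partner (trivial at p)
    (hX₁ : ClassX4Gord W₁ p) (he₁ : semistabilityIndex W₁ p = 2)
    (hSel₁ : Nat.card (W₁.selmerGroupPInfty p) = 1) (S₁ : Finset (HeightOneSpectrum (𝓞 ℚ)))
    (hS₁ : ∀ v ∈ S₁, (p : 𝓞 ℚ) ∉ v.asIdeal →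
      (primesEquiv v : ℕ) ≠ p ∧ ¬ p ∣ (W₁.baseChange (v.adicCompletion ℚ)).localTamagawaNumber
        (v.adicCompletionIntegers ℚ) * reductionPointCount W₁ (primesEquiv v : ℕ))
    (hgood₁ : ∀ v ∉ S₁, (p : 𝓞 ℚ) ∉ v.asIdeal ∧ W₁.HasGoodReductionAt v)
    -- receiver (rank 0)
    (hX₂ : ClassX4Gord W₂ p) (he₂ : semistabilityIndex W₂ p = 2) (hr₂ : W₂.analyticRank = 0)
    (S₂ : Finset (HeightOneSpectrum (𝓞 ℚ)))
    (hS₂ : ∀ v ∈ S₂, (p : 𝓞 ℚ) ∉ v.asIdeal →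
      (primesEquiv v : ℕ) ≠ p ∧ ¬ p ∣ (W₂.baseChange (v.adicCompletion ℚ)).localTamagawaNumber
        (v.adicCompletionIntegers ℚ) * reductionPointCount W₂ (primesEquiv v : ℕ))
    (hgood₂ : ∀ v ∉ S₂, (p : 𝓞 ℚ) ∉ v.asIdeal ∧ W₂.HasGoodReductionAt v)
    -- link
    (hT : TorsionIso W₁ W₂ p) (S₀ : Finset (HeightOneSpectrum (𝓞 ℚ)))
    (hS₀ : ∀ w ∈ S₀, ((p : ℕ) : 𝓞 ℚ) ∉ w.asIdeal)
    (hS₀₁ : ∀ w : HeightOneSpectrum (𝓞 ℚ), w ∉ S₀ → ((p : ℕ) : 𝓞 ℚ) ∉ w.asIdeal →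
      W₁.HasGoodReductionAt w)
    (hS₀₂ : ∀ w : HeightOneSpectrum (𝓞 ℚ), w ∉ S₀ → ((p : ℕ) : 𝓞 ℚ) ∉ w.asIdeal →
      W₂.HasGoodReductionAt w)
    (hδ : ∑ w ∈ S₀, delta W₂ p w < ∑ w ∈ S₀, delta W₁ p w)
    {κ : ZpExtension ℚ p} {γ : Field.absoluteGaloisGroup ℚ} (hκ : κ.IsCyclotomic)
    (hγ : κ.IsTopGenerator γ) (hγ' : IsCyclotomicVariable p γ) (D₂ : W₂.SelmerDualData κ γ) :
    D₂.lambda ≠ 0 := by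
  -- the partner's dual datum is zero
  obtain ⟨D₁⟩ := W₁.nonempty_selmerDualData_holds κ γ hγ
  haveI : Subsingleton D₁.X :=
    subsingleton_X_of_card_selmer_eq_one_of_localTowerKerPrimary_eq_bot D₁ hγ hSel₁
      (ClassX4Gord.localTowerKerPrimary_zero_eq_bot_of_allNumeric hX₁ κ S₁ hS₁ hgood₁)
  haveI : Module.Finite (IwasawaAlgebra p) D₁.X :=
    SelmerDualData.module_finite_of_isCyclotomic (W := W₁) (κ := κ) hκ D₁ hγ
  -- the receiver's dual datum is torsion, by control (FILE 1), from `Sel_{p^∞}(E₂/ℚ)` finite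
  obtain ⟨hrk, hfin⟩ := hGZK W₂ (by omega)
  have hrank : W₂.mordellWeilRank = 0 := by rw [hrk, hr₂]
  haveI : Finite W₂.toAffine.Point := W₂.mordellWeilRank_eq_zero_iff_finite.mp hrank
  haveI : Finite W₂.sha := hfin
  haveI : Finite (AddCommGroup.primaryComponent W₂.sha p) := inferInstance
  have hSel₂ : Finite (W₂.selmerGroupPInfty p) :=
    W₂.finite_selmerGroupPInfty_of_finite_primaryComponent p
  have hK₂ := forall_smul_eq_zero_imp_of_not_dvd_torsionOrder W₂ (p := p)
    (Supersingular.not_dvd_torsionOrder_of_irr W₂ p hX₂.1.2.2)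
  haveI : (Module.charIdeal (IwasawaAlgebra p) D₂.X).IsPrincipal := charIdeal_isPrincipal_holds p D₂.X
  obtain ⟨f₂, hf₂⟩ := Submodule.IsPrincipal.principal (Module.charIdeal (IwasawaAlgebra p) D₂.X)
  have hf₂' : D₂.charIdeal = Ideal.span {f₂} := hf₂
  obtain ⟨hFG₂, hX₂t, -⟩ := constantCoeff_mul_natCard_eq_of_no_pTorsion W₂ D₂ hγ hSel₂ hK₂ f₂ hf₂'
    (ClassX4Gord.localTowerKerPrimary_zero_eq_bot_of_allNumeric hX₂ κ S₂ hS₂ hgood₂)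
  haveI := hFG₂
  -- the GV transfer: μ(E₂) = 0 and the λ-shift
  have hRD₁ : RamifiedLineKummerEqAt W₁ p :=
    GoodModelLine.ClassX4Gord.ramifiedLineKummerEqAt_of_coatesGreenberg W₁ p hCG hX₁
  have hRD₂ : RamifiedLineKummerEqAt W₂ p :=
    GoodModelLine.ClassX4Gord.ramifiedLineKummerEqAt_of_coatesGreenberg W₂ p hCG hX₂
  have hμ₂ : D₂.mu = 0 :=
    ClassX4Gord.mu_eq_zero_of_gv_of_torsionIso hGV hX₁ he₁ hX₂ he₂ hRD₁ hRD₂ hT S₀ hS₀ hS₀₁ hS₀₂ hκ hγ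
      hγ' D₁ D₂ (isTorsion_of_subsingleton D₁) hX₂t (mu_eq_zero_of_subsingleton D₁)
  have hshift := ClassX4Gord.congruentLambdaShift_of_gv_of_torsionIso hGV hX₁ he₁ hX₂ he₂ hRD₁ hRD₂
    hT S₀ hS₀ hS₀₁ hS₀₂
  have he : ∑ w ∈ S₀, ((delta W₂ p w : ℤ) - (delta W₁ p w : ℤ)) < 0 := by
    rw [Finset.sum_sub_distrib]
    have h1 : ((∑ w ∈ S₀, delta W₂ p w : ℕ) : ℤ) < ((∑ w ∈ S₀, delta W₁ p w : ℕ) : ℤ) := by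
      exact_mod_cast hδ
    push_cast at h1
    linarith
  exact lambda_ne_zero_of_congruentLambdaShift_of_subsingleton hT hshift he hκ hγ hγ' D₁ D₂ hX₂t hμ₂

/-- **`p² ∣ #Ш(E₂/ℚ)`** on the receiver of such a pair, granted Cassels–Tate (`hCT`).
[cite: SilvermanAEC2009, Thm. X.4.14] [cite: GreenbergVatsal2000, §2 Prop. (2.8), Cor. (2.3), pp. 26–27]
[cite: GreenbergLNM1716, §4 Thm. 4.1 (pp. 102–104)] -/
theorem ClassX4Gord.sq_dvd_card_sha_rankZero_of_gv_of_trivialPartner_of_casselsTate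
    (hCT : exists_casselsTate_pairing (K := ℚ))
    (hGV : muLambdaAlg_transfer_of_torsionIso_potOrd_of_not_dvd_torsionOrder)
    (hCG : H1_goodModelKernel_trivial.{0}) (hGZK : rank_eq_analyticRank_of_analyticRank_le_one)
    (hX₁ : ClassX4Gord W₁ p) (he₁ : semistabilityIndex W₁ p = 2)
    (hSel₁ : Nat.card (W₁.selmerGroupPInfty p) = 1) (S₁ : Finset (HeightOneSpectrum (𝓞 ℚ)))
    (hS₁ : ∀ v ∈ S₁, (p : 𝓞 ℚ) ∉ v.asIdeal →
      (primesEquiv v : ℕ) ≠ p ∧ ¬ p ∣ (W₁.baseChange (v.adicCompletion ℚ)).localTamagawaNumber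
        (v.adicCompletionIntegers ℚ) * reductionPointCount W₁ (primesEquiv v : ℕ))
    (hgood₁ : ∀ v ∉ S₁, (p : 𝓞 ℚ) ∉ v.asIdeal ∧ W₁.HasGoodReductionAt v)
    (hX₂ : ClassX4Gord W₂ p) (he₂ : semistabilityIndex W₂ p = 2) (hr₂ : W₂.analyticRank = 0)
    (S₂ : Finset (HeightOneSpectrum (𝓞 ℚ)))
    (hS₂ : ∀ v ∈ S₂, (p : 𝓞 ℚ) ∉ v.asIdeal →
      (primesEquiv v : ℕ) ≠ p ∧ ¬ p ∣ (W₂.baseChange (v.adicCompletion ℚ)).localTamagawaNumber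
        (v.adicCompletionIntegers ℚ) * reductionPointCount W₂ (primesEquiv v : ℕ))
    (hgood₂ : ∀ v ∉ S₂, (p : 𝓞 ℚ) ∉ v.asIdeal ∧ W₂.HasGoodReductionAt v)
    (hT : TorsionIso W₁ W₂ p) (S₀ : Finset (HeightOneSpectrum (𝓞 ℚ)))
    (hS₀ : ∀ w ∈ S₀, ((p : ℕ) : 𝓞 ℚ) ∉ w.asIdeal)
    (hS₀₁ : ∀ w : HeightOneSpectrum (𝓞 ℚ), w ∉ S₀ → ((p : ℕ) : 𝓞 ℚ) ∉ w.asIdeal →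
      W₁.HasGoodReductionAt w)
    (hS₀₂ : ∀ w : HeightOneSpectrum (𝓞 ℚ), w ∉ S₀ → ((p : ℕ) : 𝓞 ℚ) ∉ w.asIdeal →
      W₂.HasGoodReductionAt w)
    (hδ : ∑ w ∈ S₀, delta W₂ p w < ∑ w ∈ S₀, delta W₁ p w) : p ^ 2 ∣ Nat.card W₂.sha := by
  obtain ⟨κ, hκ, γ, hγ, hγ'⟩ := exists_isCyclotomic_isTopGenerator_isCyclotomicVariable_holds p
  obtain ⟨D₂⟩ := W₂.nonempty_selmerDualData_holds κ γ hγ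
  exact sq_dvd_card_sha_rankZero_of_lambda_ne_zero_of_casselsTate W₂ p hCT hGZK hr₂
    (Supersingular.not_dvd_torsionOrder_of_irr W₂ p hX₂.1.2.2) D₂ hγ
    (ClassX4Gord.lambda_ne_zero_of_gv_of_trivialPartner hGV hCG hGZK hX₁ he₁ hSel₁ S₁ hS₁ hgood₁ hX₂ he₂
      hr₂ S₂ hS₂ hgood₂ hT S₀ hS₀ hS₀₁ hS₀₂ hδ hκ hγ hγ' D₂)
    (ClassX4Gord.localTowerKerPrimary_zero_eq_bot_of_allNumeric hX₂ κ S₂ hS₂ hgood₂)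

/-- **THE LOWER HALF ON THE RECEIVER, NO TYPED INPUT**: X4♯(G-ord) ∩ `I₀*` pair, trivial partner,
positive δ-shift, `ord_p #Ш_an(E₂) ≤ 2` ⟹ `Typed.MissingLowerBoundAt W₂ p`. Nothing booked.
[cite: SilvermanAEC2009, Thm. X.4.14] [cite: GreenbergVatsal2000, §2 Prop. (2.8), Cor. (2.3), pp. 26–27]
[cite: Miller2011LMS, Def. 1.1] [cite: GreenbergLNM1716, §4 Thm. 4.1 (pp. 102–104)] -/
theorem ClassX4Gord.missingLowerBoundAt_rankZero_of_gv_of_trivialPartner_of_casselsTate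
    (hCT : exists_casselsTate_pairing (K := ℚ))
    (hGV : muLambdaAlg_transfer_of_torsionIso_potOrd_of_not_dvd_torsionOrder)
    (hCG : H1_goodModelKernel_trivial.{0}) (hGZK : rank_eq_analyticRank_of_analyticRank_le_one)
    (hX₁ : ClassX4Gord W₁ p) (he₁ : semistabilityIndex W₁ p = 2)
    (hSel₁ : Nat.card (W₁.selmerGroupPInfty p) = 1) (S₁ : Finset (HeightOneSpectrum (𝓞 ℚ)))
    (hS₁ : ∀ v ∈ S₁, (p : 𝓞 ℚ) ∉ v.asIdeal →
      (primesEquiv v : ℕ) ≠ p ∧ ¬ p ∣ (W₁.baseChange (v.adicCompletion ℚ)).localTamagawaNumber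
        (v.adicCompletionIntegers ℚ) * reductionPointCount W₁ (primesEquiv v : ℕ))
    (hgood₁ : ∀ v ∉ S₁, (p : 𝓞 ℚ) ∉ v.asIdeal ∧ W₁.HasGoodReductionAt v)
    (hX₂ : ClassX4Gord W₂ p) (he₂ : semistabilityIndex W₂ p = 2) (hr₂ : W₂.analyticRank = 0)
    (S₂ : Finset (HeightOneSpectrum (𝓞 ℚ)))
    (hS₂ : ∀ v ∈ S₂, (p : 𝓞 ℚ) ∉ v.asIdeal →
      (primesEquiv v : ℕ) ≠ p ∧ ¬ p ∣ (W₂.baseChange (v.adicCompletion ℚ)).localTamagawaNumber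
        (v.adicCompletionIntegers ℚ) * reductionPointCount W₂ (primesEquiv v : ℕ))
    (hgood₂ : ∀ v ∉ S₂, (p : 𝓞 ℚ) ∉ v.asIdeal ∧ W₂.HasGoodReductionAt v)
    (hT : TorsionIso W₁ W₂ p) (S₀ : Finset (HeightOneSpectrum (𝓞 ℚ)))
    (hS₀ : ∀ w ∈ S₀, ((p : ℕ) : 𝓞 ℚ) ∉ w.asIdeal)
    (hS₀₁ : ∀ w : HeightOneSpectrum (𝓞 ℚ), w ∉ S₀ → ((p : ℕ) : 𝓞 ℚ) ∉ w.asIdeal →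
      W₁.HasGoodReductionAt w)
    (hS₀₂ : ∀ w : HeightOneSpectrum (𝓞 ℚ), w ∉ S₀ → ((p : ℕ) : 𝓞 ℚ) ∉ w.asIdeal →
      W₂.HasGoodReductionAt w)
    (hδ : ∑ w ∈ S₀, delta W₂ p w < ∑ w ∈ S₀, delta W₁ p w)
    (hsha : ∃ s : ℚ, shaAn W₂ = (s : ℂ) ∧ padicValRat p s ≤ 2) : MissingLowerBoundAt W₂ p := by
  obtain ⟨κ, hκ, γ, hγ, hγ'⟩ := exists_isCyclotomic_isTopGenerator_isCyclotomicVariable_holds p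
  obtain ⟨D₂⟩ := W₂.nonempty_selmerDualData_holds κ γ hγ
  exact ClassX4Gord.missingLowerBoundAt_rankZero_of_lambda_ne_zero_of_casselsTate hCT hX₂ hGZK hr₂ D₂ hγ
    (ClassX4Gord.lambda_ne_zero_of_gv_of_trivialPartner hGV hCG hGZK hX₁ he₁ hSel₁ S₁ hS₁ hgood₁ hX₂ he₂
      hr₂ S₂ hS₂ hgood₂ hT S₀ hS₀ hS₀₁ hS₀₂ hδ hκ hγ hγ' D₂) S₂ hS₂ hgood₂ hsha

/-- **CAPSTONE — `BSD(E₂,p)` on the receiver of such a pair, every input PRINTED or census**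
(`p ≥ 5`, `ρ̄_{E₂,p}` onto, `p ∤ ∏ c_ℓ(E₂)`, `ord_p #Ш_an(E₂) ≤ 2`): PRINTED {Cassels–Tate `hCT`, Kato
14.5 (3) Manin-free `hKatoMF`, Delbourgo 1998 Prop. 4 `hDel98`, GZK, modularity `hmod`/`hmodD`,
Wuthrich–Kato component `hKatoχ`, A240 `hGV`, Coates–Greenberg `hCG`} + receiver census + partner census
+ link (`TorsionIso`, `S₀`, δ-inequality). X4 is NOT closed as a class; the per-pair hypotheses are
census currencies; nothing booked. [cite: Kato2004Asterisque, Thm. 14.5 (3) (p. 236)]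
[cite: Delbourgo1998, Prop. 4 (p. 144)] [cite: SilvermanAEC2009, Thm. X.4.14]
[cite: GreenbergVatsal2000, §2 Prop. (2.8), Cor. (2.3), pp. 26–27] [cite: Miller2011LMS, Def. 1.1] -/
theorem ClassX4Gord.bsdp_rankZero_of_gv_of_trivialPartner_of_casselsTate_maninFree
    (hCT : exists_casselsTate_pairing (K := ℚ))
    (hKatoMF : Kato2004.rankZero_padicValNat_sha_le_sub_localTamagawa_of_additive_potGood_of_imageContainsSL2_maninFree)
    (hDel98 : Delbourgo1998.prop4_rankZero_pow_dvd_constantCoeff)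
    (hGZK : rank_eq_analyticRank_of_analyticRank_le_one) (hmod : hasEntireLFunction_rat)
    (hmodD : nonempty_modularParametrizationData)
    (hKatoχ : Wuthrich2014.kato_halfEigenCharIdeal_dvd_cyclotomicPrime_of_surjective)
    (hGV : muLambdaAlg_transfer_of_torsionIso_potOrd_of_not_dvd_torsionOrder)
    (hCG : H1_goodModelKernel_trivial.{0})
    -- partner
    (hX₁ : ClassX4Gord W₁ p) (he₁ : semistabilityIndex W₁ p = 2)
    (hSel₁ : Nat.card (W₁.selmerGroupPInfty p) = 1) (S₁ : Finset (HeightOneSpectrum (𝓞 ℚ)))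
    (hS₁ : ∀ v ∈ S₁, (p : 𝓞 ℚ) ∉ v.asIdeal →
      (primesEquiv v : ℕ) ≠ p ∧ ¬ p ∣ (W₁.baseChange (v.adicCompletion ℚ)).localTamagawaNumber
        (v.adicCompletionIntegers ℚ) * reductionPointCount W₁ (primesEquiv v : ℕ))
    (hgood₁ : ∀ v ∉ S₁, (p : 𝓞 ℚ) ∉ v.asIdeal ∧ W₁.HasGoodReductionAt v)
    -- receiver
    (hX₂ : ClassX4Gord W₂ p) (he₂ : semistabilityIndex W₂ p = 2) (hp5 : 5 ≤ p)
    (hr₂ : W₂.analyticRank = 0) (hsurj₂ : Surj W₂ p) (htam₂ : ¬ p ∣ W₂.tamagawaProduct)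
    (S₂ : Finset (HeightOneSpectrum (𝓞 ℚ)))
    (hS₂ : ∀ v ∈ S₂, (p : 𝓞 ℚ) ∉ v.asIdeal →
      (primesEquiv v : ℕ) ≠ p ∧ ¬ p ∣ (W₂.baseChange (v.adicCompletion ℚ)).localTamagawaNumber
        (v.adicCompletionIntegers ℚ) * reductionPointCount W₂ (primesEquiv v : ℕ))
    (hgood₂ : ∀ v ∉ S₂, (p : 𝓞 ℚ) ∉ v.asIdeal ∧ W₂.HasGoodReductionAt v)
    (hsha : ∃ s : ℚ, shaAn W₂ = (s : ℂ) ∧ padicValRat p s ≤ 2)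
    -- link
    (hT : TorsionIso W₁ W₂ p) (S₀ : Finset (HeightOneSpectrum (𝓞 ℚ)))
    (hS₀ : ∀ w ∈ S₀, ((p : ℕ) : 𝓞 ℚ) ∉ w.asIdeal)
    (hS₀₁ : ∀ w : HeightOneSpectrum (𝓞 ℚ), w ∉ S₀ → ((p : ℕ) : 𝓞 ℚ) ∉ w.asIdeal →
      W₁.HasGoodReductionAt w)
    (hS₀₂ : ∀ w : HeightOneSpectrum (𝓞 ℚ), w ∉ S₀ → ((p : ℕ) : 𝓞 ℚ) ∉ w.asIdeal →
      W₂.HasGoodReductionAt w)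
    (hδ : ∑ w ∈ S₀, delta W₂ p w < ∑ w ∈ S₀, delta W₁ p w) : BSDp W₂ p :=
  bsdp_of_missingPPartAt W₂ p hGZK (by rw [hr₂]; exact zero_le_one)
    (missingPPartAt_of_lower_of_upper W₂ p
      (ClassX4Gord.missingLowerBoundAt_rankZero_of_gv_of_trivialPartner_of_casselsTate hCT hGV hCG hGZK
        hX₁ he₁ hSel₁ S₁ hS₁ hgood₁ hX₂ he₂ hr₂ S₂ hS₂ hgood₂ hT S₀ hS₀ hS₀₁ hS₀₂ hδ hsha)
      (X4RankZero.missingUpperBoundAt_of_facts_of_five_le_maninFree W₂ p hKatoMF hDel98 hGZK hmod hmodD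
        hKatoχ hp5 hr₂ hX₂.1 hsurj₂ (Or.inr htam₂)))

end Pair

end Summit.BirchSwinnertonDyer.Rank1Residual.Additive

end
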